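import Literature.IUT.HodgeArakelov.LabelClassesOfCuspsCor24iiAssemblyOfCoverModelInter
import Literature.AnabelianGeometry.EtaleTheta.Discharge.Sec1DecompLeKerToZ
import HarnessLib

/-!
# [IUTchII] Cor 2.4 (ii)(iii)′ at the genuine `±`-tower, intersection-keyed: the origin input reduced to R2 at `N = 2`
# ((P3) is now a theorem — abc-iut-w6-d092's `ThetaSetting.decomp_le_ker_toZ_of_root`, p444358)

S. Mochizuki, *Inter-universal Teichmüller Theory II*, kurims manuscript (Dec. 2020), §2 Cor. 2.4 (ii)(a) p. 70, Def. 2.3 (ii) p. 68;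
*The étale theta function …* [EtTh], §1 PRIMS p. 13 («this image determines a Galois covering `Y_N → Y` … whose kernel we denote by
`Π^tp_{Y_N}`»), p. 17 («`Ÿ = Y₂`»). [cite: Mochizuki2012, II Cor 2.4 (ii) p.70] [cite: MochizukiEtTh2009, §1 p.13]
abc-iut cell, layer L6, node **IUTchII:Cor2.4(ii)**; seat abc-iut-w6-d069 (gen 2); sequel BY NAME to this seat's p444353 / p444923
(`cuspDecomp_one_le_map_YddL_ofCoverModel_of_inter`, `cor24_ii_iii'_ofCoverModel_of_inter`), to p438495
(`ThetaSetting.decomp_inf_le_GtpYN_of_gtpYNFromCusp`) and to abc-iut-w6-d092's p444358 (`ThetaSetting.decomp_le_ker_toZ_of_root`: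
the SettingBridge parameter (P3) «`D_x ⊆ Π^tp_Y` for every cusp `x`» holds for EVERY `ThetaSetting`).  PROOF-ONLY (0 `def`).

CONTENT.  The cusp-splitting input of sub-node (a.2) («`D_x ⊆ Π^tp_{Y₂} = Π^tp_Ÿ`», GAP-LEDGER G-w6d069-1 at `N = 2`) now follows from
the SINGLE [EtTh]-side clause R2 «`Π^tp_{Y_N}` is cut out by the cusp section» AT `N = 2` ONLY (`Thm16Sub.GtpYNFromCusp _ 2`, F-3213 /
field `gtpYN_fromCusp` of `IsThm16Origin`): `ThetaSetting.decomp_le_GtpYN_two_of_gtpYNFromCusp_two`.  Hence, over ANY intersection-keyed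
cusp datum `Ci` on `W := ofCoverModel …` (hypothesis `hint`, print's Def 2.3 (ii) rule; such data exist with inhabited `Π_v`-family,
p444923 `exists_interKeyed_cuspidalInertiaData_ofCoverModel`):
* `cuspDecomp_one_le_map_YddL_ofCoverModel_of_inter_of_gtpYNFromCusp_two` — the closers' binder `hYdd` modulo ⟨F-1704 `habs`,
  F-1708 `hcomm`, R2 at `N = 2`⟩;
* `cor24_ii_iii'_ofCoverModel_of_inter_of_gtpYNFromCusp_two` — the node's typed statement `Cor24_ii_iii' W Ci H` modulo ⟨node Cor. 2.4 (i)
  at `Ci` (`h24i`); (S) `hsurj`; (E) `hcap`; F-1704; F-1708; R2 at `N = 2`⟩, and `…_of_thm16Origin` (R2 packaged in `IsThm16Origin`,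
  no `OncePuncturedData` binder).
HONEST LIMITS: all inputs are named HYPOTHESES; nothing of [EtTh] is asserted; no side is taken on [IUTchIII] Cor. 3.12; typed ≠ proved.
-/

noncomputable section

namespace Literature.AnabelianGeometry.EtaleTheta.ThetaSetting

variable {p : ℕ} [Fact p.Prime] (D : ThetaSetting p)

/-- **«`D_x ⊆ Π^tp_{Y₂}` for every cusp `x`» from R2 at `N = 2` alone** ([EtTh] §1 p. 13, p. 17 «`Ÿ = Y₂`»; `K = K̈` under `Sec2Hyps`):
the (←) direction of `Thm16Sub.GtpYNFromCusp D 2` at `Dc := D_x` — the clause «`D_x ⊆ Π^tp_Y`» ((P3)) being abc-iut-w6-d092's theorem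
`decomp_le_ker_toZ_of_root`, the `G_{K₂}`-condition being `aug(Π^tp_X) = G_K = G_{K₂}` (`aug_mem_GK`, `Sec2Hyps.GKdd_eq`).  PROVED.
[cite: MochizukiEtTh2009, §1 p.13] -/
theorem decomp_le_GtpYN_two_of_gtpYNFromCusp_two (hS : D.Sec2Hyps) (hR2 : Thm16Sub.GtpYNFromCusp D 2) :
    ∀ x : D.Pt, D.IsCusp x → D.decomp x ≤ D.GtpYN 2 := by
  intro x hx g hg
  have h := D.decomp_inf_le_GtpYN_of_gtpYNFromCusp 2 hR2 D.decomp_le_ker_toZ_field_redundant x hx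
  have h2 : D.GKN 2 = D.GK := ThetaSetting.Sec2Hyps.GKdd_eq hS
  refine h (Subgroup.mem_inf.mpr ⟨hg, ?_⟩)
  rw [Subgroup.mem_comap, h2]
  exact ThetaSetting.aug_mem_GK D g

/-- **The printed `N`-indexed cusp-splitting clause for EVERY `N`, from `IsThm16Origin` alone** (R2 for all `N` + the theorem (P3)) —
p438495's `decomp_inf_le_GtpYN_of_origin` WITHOUT its `OncePuncturedData` binder.  PROVED. [cite: MochizukiEtTh2009, §1 p.13] -/
theorem decomp_inf_le_GtpYN_of_thm16Origin (hO : D.IsThm16Origin) :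
    ∀ x : D.Pt, D.IsCusp x → ∀ N : ℕ+, D.decomp x ⊓ (D.GKN N).comap D.aug.toMonoidHom ≤ D.GtpYN N :=
  fun x hx N => D.decomp_inf_le_GtpYN_of_gtpYNFromCusp N (hO.gtpYN_fromCusp N) D.decomp_le_ker_toZ_field_redundant x hx

end Literature.AnabelianGeometry.EtaleTheta.ThetaSetting

namespace Literature.IUT.HodgeArakelov

open Literature.AnabelianGeometry.EtaleTheta Literature.AnabelianGeometry.SemiGraphs
open scoped Pointwise

namespace PlusMinusTower

variable {p : ℕ} [Fact p.Prime] {M : MuTwoSetting p} (e : M.CLevelData)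
  {E : M.toThetaSetting.EtaleThetaData} {l : ℕ} (C : E.DoubleUnderline l) {N : ℕ+}
  (μ : M.toThetaSetting.CyclotomeMod l N) (hC : M.toThetaSetting.Compat) (hS : M.toThetaSetting.Sec2Hyps)
  (hl : l.Prime) (hp2 : p ≠ 2) (hpl : p ≠ l) (hζ : ∃ ζ : M.toThetaSetting.K, IsPrimitiveRoot ζ (4 * l))
  {η : (C.thetaEnvData μ hC hS).PiYdd → MuN p N} (hη : η ∈ (C.thetaEnvData μ hC hS).thetaCocycles)
  {Q : Type} [Group Q] [TopologicalSpace Q] [IsTopologicalGroup Q]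
  (ι : M.GtpC →ₜ* Q) (hι : IsProfiniteCompletion ι) (hinj : Function.Injective ι)
  (Φ : Q →* GQp p) (hΦ : ∀ g : M.GtpC, Φ (ι g) = e.augC g) (hΦK : Φ.range = M.GK)
  (hZ : Thm16Sub.KerToZIsCompactlyGenerated M.toThetaSetting) (hN : (C.Huu.subgroupOf (M.GtpXu l)).Normal)
  {P : TopGroup.{0}} (T : TemperedCoverings (BadPlaceSetting.ofUnderline C μ hC hS hl hp2 hpl hζ hη) P)

/-- **(a.2) at `Π_v` for print's intersection family, modulo ⟨F-1704, F-1708, R2 at `N = 2`⟩ only** (kurims p. 70; Def. 2.3 (ii) p. 68):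
the closers' binder `hYdd` for every intersection-keyed `Ci` on `ofCoverModel`.  PROVED (p444353 `…_of_inter` ∘
`decomp_le_GtpYN_two_of_gtpYNFromCusp_two`). [claim: Mochizuki2012, status: disputed] (IUTchII §2 Cor 2.4 (ii)(a) p.70) -/
theorem cuspDecomp_one_le_map_YddL_ofCoverModel_of_inter_of_gtpYNFromCusp_two
    (Ci : CuspidalInertiaData (ofCoverModel e C μ hC hS hl hp2 hpl hζ hη ι hι hinj Φ hΦ hΦK hZ hN T))
    (hint : ∀ I : Subgroup (ofCoverModel e C μ hC hS hl hp2 hpl hζ hη ι hι hinj Φ hΦ hΦK hZ hN T).Corhat,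
      Ci.IsCuspidalInertia (ofCoverModel e C μ hC hS hl hp2 hpl hζ hη ι hι hinj Φ hΦ hΦK hZ hN T).piV I →
        ∃ i : {x : M.Pt // M.IsCusp x} × M.GtpC,
          ∃ t ∈ (ofCoverModel e C μ hC hS hl hp2 hpl hζ hη ι hι hinj Φ hΦ hΦK hZ hN T).piPM,
            I = (MulAut.conj t •
              (((MulAut.conj i.2 • (M.toTemperedCurve.inertia i.1.1).map M.inclX) ⊓ (M.GtpXu l).map M.inclX).map
                ι.toMonoidHom :
                Subgroup (ofCoverModel e C μ hC hS hl hp2 hpl hζ hη ι hι hinj Φ hΦ hΦK hZ hN T).Corhat)) ⊓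
              (ofCoverModel e C μ hC hS hl hp2 hpl hζ hη ι hι hinj Φ hΦ hΦK hZ hN T).piV)
    (habs : M.toTemperedCurve.IsoPreservesCuspidalDecomp M.toTemperedCurve)
    (hcomm : M.toTemperedCurve.DecompEqCommensuratorOfOpenInertia)
    (hR2 : Thm16Sub.GtpYNFromCusp M.toThetaSetting 2) (H : Subgroup P) :
    ∀ I : Subgroup (ofCoverModel e C μ hC hS hl hp2 hpl hζ hη ι hι hinj Φ hΦ hΦK hZ hN T).Corhat,
      Ci.IsCuspidalInertia (ofCoverModel e C μ hC hS hl hp2 hpl hζ hη ι hι hinj Φ hΦ hΦK hZ hN T).piV I →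
        I ≤ (ofCoverModel e C μ hC hS hl hp2 hpl hζ hη ι hι hinj Φ hΦ hΦK hZ hN T).deltaBox H →
          (ofCoverModel e C μ hC hS hl hp2 hpl hζ hη ι hι hinj Φ hΦ hΦK hZ hN T).cuspDecomp I 1 ≤
            (T.YddL).map ((ofCoverModel e C μ hC hS hl hp2 hpl hζ hη ι hι hinj Φ hΦ hΦK hZ hN T).emb.comp T.incl) :=
  cuspDecomp_one_le_map_YddL_ofCoverModel_of_inter e C μ hC hS hl hp2 hpl hζ hη ι hι hinj Φ hΦ hΦK hZ hN T Ci hint habs hcomm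
    (M.toThetaSetting.decomp_le_GtpYN_two_of_gtpYNFromCusp_two hS hR2) H

/-- **IUTchII:Cor2.4(ii)(iii)′ at `ofCoverModel` over ANY intersection-keyed datum, modulo ⟨node Cor. 2.4 (i) (`h24i`); (S) `hsurj`;
(E) `hcap`; F-1704 `habs`; F-1708 `hcomm`; R2 at `N = 2` (`hR2`, F-3213)⟩** — no (P3), no `OncePuncturedData`.  PROVED.
[claim: Mochizuki2012, status: disputed] (IUTchII §2 Cor 2.4 (ii) p.70) -/
theorem cor24_ii_iii'_ofCoverModel_of_inter_of_gtpYNFromCusp_two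
    (Ci : CuspidalInertiaData (ofCoverModel e C μ hC hS hl hp2 hpl hζ hη ι hι hinj Φ hΦ hΦK hZ hN T))
    (hint : ∀ I : Subgroup (ofCoverModel e C μ hC hS hl hp2 hpl hζ hη ι hι hinj Φ hΦ hΦK hZ hN T).Corhat,
      Ci.IsCuspidalInertia (ofCoverModel e C μ hC hS hl hp2 hpl hζ hη ι hι hinj Φ hΦ hΦK hZ hN T).piV I →
        ∃ i : {x : M.Pt // M.IsCusp x} × M.GtpC,
          ∃ t ∈ (ofCoverModel e C μ hC hS hl hp2 hpl hζ hη ι hι hinj Φ hΦ hΦK hZ hN T).piPM,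
            I = (MulAut.conj t •
              (((MulAut.conj i.2 • (M.toTemperedCurve.inertia i.1.1).map M.inclX) ⊓ (M.GtpXu l).map M.inclX).map
                ι.toMonoidHom :
                Subgroup (ofCoverModel e C μ hC hS hl hp2 hpl hζ hη ι hι hinj Φ hΦ hΦK hZ hN T).Corhat)) ⊓
              (ofCoverModel e C μ hC hS hl hp2 hpl hζ hη ι hι hinj Φ hΦ hΦK hZ hN T).piV)
    (H : Subgroup P)
    (h24i : ∀ I : Subgroup (ofCoverModel e C μ hC hS hl hp2 hpl hζ hη ι hι hinj Φ hΦ hΦK hZ hN T).Corhat,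
      Ci.IsCuspidalInertia (ofCoverModel e C μ hC hS hl hp2 hpl hζ hη ι hι hinj Φ hΦ hΦK hZ hN T).piV I →
        I ≤ (ofCoverModel e C μ hC hS hl hp2 hpl hζ hη ι hι hinj Φ hΦ hΦK hZ hN T).deltaBox H →
          Literature.IUT.HodgeArakelov.Cor24_i (ofCoverModel e C μ hC hS hl hp2 hpl hζ hη ι hι hinj Φ hΦ hΦK hZ hN T) Ci H I)
    (hsurj : ∀ n : (ofCoverModel e C μ hC hS hl hp2 hpl hζ hη ι hι hinj Φ hΦ hΦK hZ hN T).Corhat,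
      n ∈ (ofCoverModel e C μ hC hS hl hp2 hpl hζ hη ι hι hinj Φ hΦ hΦK hZ hN T).piV →
        ∃ m : (ofCoverModel e C μ hC hS hl hp2 hpl hζ hη ι hι hinj Φ hΦ hΦK hZ hN T).Corhat,
          m ∈ (ofCoverModel e C μ hC hS hl hp2 hpl hζ hη ι hι hinj Φ hΦ hΦK hZ hN T).pmBox H ∧
            m⁻¹ * n ∈ (ofCoverModel e C μ hC hS hl hp2 hpl hζ hη ι hι hinj Φ hΦ hΦK hZ hN T).aug.ker)
    (hcap : (ofCoverModel e C μ hC hS hl hp2 hpl hζ hη ι hι hinj Φ hΦ hΦK hZ hN T).pmBox H ⊓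
        (ofCoverModel e C μ hC hS hl hp2 hpl hζ hη ι hι hinj Φ hΦ hΦK hZ hN T).piV ≤
      (ofCoverModel e C μ hC hS hl hp2 hpl hζ hη ι hι hinj Φ hΦ hΦK hZ hN T).box H)
    (habs : M.toTemperedCurve.IsoPreservesCuspidalDecomp M.toTemperedCurve)
    (hcomm : M.toTemperedCurve.DecompEqCommensuratorOfOpenInertia)
    (hR2 : Thm16Sub.GtpYNFromCusp M.toThetaSetting 2) :
    Literature.IUT.HodgeArakelov.Cor24_ii_iii' (ofCoverModel e C μ hC hS hl hp2 hpl hζ hη ι hι hinj Φ hΦ hΦK hZ hN T) Ci H :=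
  cor24_ii_iii'_ofCoverModel_of_inter e C μ hC hS hl hp2 hpl hζ hη ι hι hinj Φ hΦ hΦK hZ hN T Ci hint H h24i hsurj hcap habs hcomm
    (M.toThetaSetting.decomp_le_GtpYN_two_of_gtpYNFromCusp_two hS hR2)

/-- **IUTchII:Cor2.4(ii)(iii)′ at `ofCoverModel` over ANY intersection-keyed datum, modulo ⟨node Cor. 2.4 (i); (S); (E); F-1704; F-1708;
`IsThm16Origin`⟩** — p444923's `…_of_inter_of_origin` WITHOUT the `OncePuncturedData` binder.  PROVED.
[claim: Mochizuki2012, status: disputed] (IUTchII §2 Cor 2.4 (ii) p.70) -/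
theorem cor24_ii_iii'_ofCoverModel_of_inter_of_thm16Origin
    (Ci : CuspidalInertiaData (ofCoverModel e C μ hC hS hl hp2 hpl hζ hη ι hι hinj Φ hΦ hΦK hZ hN T))
    (hint : ∀ I : Subgroup (ofCoverModel e C μ hC hS hl hp2 hpl hζ hη ι hι hinj Φ hΦ hΦK hZ hN T).Corhat,
      Ci.IsCuspidalInertia (ofCoverModel e C μ hC hS hl hp2 hpl hζ hη ι hι hinj Φ hΦ hΦK hZ hN T).piV I →
        ∃ i : {x : M.Pt // M.IsCusp x} × M.GtpC,
          ∃ t ∈ (ofCoverModel e C μ hC hS hl hp2 hpl hζ hη ι hι hinj Φ hΦ hΦK hZ hN T).piPM,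
            I = (MulAut.conj t •
              (((MulAut.conj i.2 • (M.toTemperedCurve.inertia i.1.1).map M.inclX) ⊓ (M.GtpXu l).map M.inclX).map
                ι.toMonoidHom :
                Subgroup (ofCoverModel e C μ hC hS hl hp2 hpl hζ hη ι hι hinj Φ hΦ hΦK hZ hN T).Corhat)) ⊓
              (ofCoverModel e C μ hC hS hl hp2 hpl hζ hη ι hι hinj Φ hΦ hΦK hZ hN T).piV)
    (H : Subgroup P)
    (h24i : ∀ I : Subgroup (ofCoverModel e C μ hC hS hl hp2 hpl hζ hη ι hι hinj Φ hΦ hΦK hZ hN T).Corhat,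
      Ci.IsCuspidalInertia (ofCoverModel e C μ hC hS hl hp2 hpl hζ hη ι hι hinj Φ hΦ hΦK hZ hN T).piV I →
        I ≤ (ofCoverModel e C μ hC hS hl hp2 hpl hζ hη ι hι hinj Φ hΦ hΦK hZ hN T).deltaBox H →
          Literature.IUT.HodgeArakelov.Cor24_i (ofCoverModel e C μ hC hS hl hp2 hpl hζ hη ι hι hinj Φ hΦ hΦK hZ hN T) Ci H I)
    (hsurj : ∀ n : (ofCoverModel e C μ hC hS hl hp2 hpl hζ hη ι hι hinj Φ hΦ hΦK hZ hN T).Corhat,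
      n ∈ (ofCoverModel e C μ hC hS hl hp2 hpl hζ hη ι hι hinj Φ hΦ hΦK hZ hN T).piV →
        ∃ m : (ofCoverModel e C μ hC hS hl hp2 hpl hζ hη ι hι hinj Φ hΦ hΦK hZ hN T).Corhat,
          m ∈ (ofCoverModel e C μ hC hS hl hp2 hpl hζ hη ι hι hinj Φ hΦ hΦK hZ hN T).pmBox H ∧
            m⁻¹ * n ∈ (ofCoverModel e C μ hC hS hl hp2 hpl hζ hη ι hι hinj Φ hΦ hΦK hZ hN T).aug.ker)
    (hcap : (ofCoverModel e C μ hC hS hl hp2 hpl hζ hη ι hι hinj Φ hΦ hΦK hZ hN T).pmBox H ⊓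
        (ofCoverModel e C μ hC hS hl hp2 hpl hζ hη ι hι hinj Φ hΦ hΦK hZ hN T).piV ≤
      (ofCoverModel e C μ hC hS hl hp2 hpl hζ hη ι hι hinj Φ hΦ hΦK hZ hN T).box H)
    (habs : M.toTemperedCurve.IsoPreservesCuspidalDecomp M.toTemperedCurve)
    (hcomm : M.toTemperedCurve.DecompEqCommensuratorOfOpenInertia)
    (hO : M.toThetaSetting.IsThm16Origin) :
    Literature.IUT.HodgeArakelov.Cor24_ii_iii' (ofCoverModel e C μ hC hS hl hp2 hpl hζ hη ι hι hinj Φ hΦ hΦK hZ hN T) Ci H :=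
  cor24_ii_iii'_ofCoverModel_of_inter_of_gtpYNFromCusp_two e C μ hC hS hl hp2 hpl hζ hη ι hι hinj Φ hΦ hΦK hZ hN T Ci hint H h24i hsurj hcap habs hcomm (hO.gtpYN_fromCusp 2)

/-! ### v2 (append-only): data given by print's LEVELS CLAUSE — the shape of the agreement of record p433029

abc-iut-w5-d132's agreement of record at the genuine pair (`exists_stableCurveAgreement_ofPiCHat_ofSpecialFibre`, p433029; `ofPiCHat` IS
`ofCoverModel` at `ι := toPiCHat`, `PlusMinusTower.ofPiCHat` unfolds by `rfl`) carries its cusp datum in print's Def 2.3 (ii) form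
«`Cu.IsCuspidalInertia Q I ↔ I ≤ Q ∧ ∃ I₀, Cu.IsCuspidalInertia Π^±_v I₀ ∧ I = I₀ ∩ Q`» (hypothesis `hlev` below, VERBATIM shape).  For such
data the intersection rule `hint` of §3 of p444353 / p444923 holds as soon as the `Π^±_v`-cuspidal groups are members of the tempered cusp
family (hypothesis `hpm` — for p433029 this is the content of the B13/B15 dictionaries of the w5-d132 / L6-t19 lineages, read through
`eHat`; it is NOT derived here).  So the node's statement at a levels-keyed datum is one named binder (`hpm`) away from the by-name inputs. -/

/-- **Print's levels clause + «`Π^±_v`-cuspidal groups are members» ⇒ the intersection rule `hint`** (Def. 2.3 (ii) p. 68).  PROVED.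
[claim: Mochizuki2012, status: disputed] (IUTchII §2 Def 2.3 (ii), kurims p.68) -/
theorem hint_of_levels_of_members
    (Cu : CuspidalInertiaData (ofCoverModel e C μ hC hS hl hp2 hpl hζ hη ι hι hinj Φ hΦ hΦK hZ hN T))
    (hlev : ∀ Q' I : Subgroup (ofCoverModel e C μ hC hS hl hp2 hpl hζ hη ι hι hinj Φ hΦ hΦK hZ hN T).Corhat,
      Cu.IsCuspidalInertia Q' I ↔ I ≤ Q' ∧ ∃ I₀,
        Cu.IsCuspidalInertia (ofCoverModel e C μ hC hS hl hp2 hpl hζ hη ι hι hinj Φ hΦ hΦK hZ hN T).piPM I₀ ∧ I = I₀ ⊓ Q')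
    (hpm : ∀ I₀ : Subgroup (ofCoverModel e C μ hC hS hl hp2 hpl hζ hη ι hι hinj Φ hΦ hΦK hZ hN T).Corhat,
      Cu.IsCuspidalInertia (ofCoverModel e C μ hC hS hl hp2 hpl hζ hη ι hι hinj Φ hΦ hΦK hZ hN T).piPM I₀ →
        ∃ i : {x : M.Pt // M.IsCusp x} × M.GtpC,
          ∃ t ∈ (ofCoverModel e C μ hC hS hl hp2 hpl hζ hη ι hι hinj Φ hΦ hΦK hZ hN T).piPM,
            I₀ = (MulAut.conj t •
              (((MulAut.conj i.2 • (M.toTemperedCurve.inertia i.1.1).map M.inclX) ⊓ (M.GtpXu l).map M.inclX).map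
                ι.toMonoidHom :
                Subgroup (ofCoverModel e C μ hC hS hl hp2 hpl hζ hη ι hι hinj Φ hΦ hΦK hZ hN T).Corhat))) :
    ∀ I : Subgroup (ofCoverModel e C μ hC hS hl hp2 hpl hζ hη ι hι hinj Φ hΦ hΦK hZ hN T).Corhat,
      Cu.IsCuspidalInertia (ofCoverModel e C μ hC hS hl hp2 hpl hζ hη ι hι hinj Φ hΦ hΦK hZ hN T).piV I →
        ∃ i : {x : M.Pt // M.IsCusp x} × M.GtpC,
          ∃ t ∈ (ofCoverModel e C μ hC hS hl hp2 hpl hζ hη ι hι hinj Φ hΦ hΦK hZ hN T).piPM,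
            I = (MulAut.conj t •
              (((MulAut.conj i.2 • (M.toTemperedCurve.inertia i.1.1).map M.inclX) ⊓ (M.GtpXu l).map M.inclX).map
                ι.toMonoidHom :
                Subgroup (ofCoverModel e C μ hC hS hl hp2 hpl hζ hη ι hι hinj Φ hΦ hΦK hZ hN T).Corhat)) ⊓
              (ofCoverModel e C μ hC hS hl hp2 hpl hζ hη ι hι hinj Φ hΦ hΦK hZ hN T).piV := by
  intro I hI
  obtain ⟨-, I₀, hI₀, rfl⟩ := (hlev _ _).mp hI
  obtain ⟨i, t, ht, rfl⟩ := hpm I₀ hI₀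
  exact ⟨i, t, ht, rfl⟩

/-- **(a.2) — the closers' binder `hYdd` — for a LEVELS-keyed datum (shape of p433029)**, modulo ⟨`hpm`; F-1704 `habs`; F-1708 `hcomm`;
R2 at `N = 2`⟩.  PROVED. [claim: Mochizuki2012, status: disputed] (IUTchII §2 Cor 2.4 (ii)(a) p.70) -/
theorem cuspDecomp_one_le_map_YddL_ofCoverModel_of_levels_of_members
    (Cu : CuspidalInertiaData (ofCoverModel e C μ hC hS hl hp2 hpl hζ hη ι hι hinj Φ hΦ hΦK hZ hN T))
    (hlev : ∀ Q' I : Subgroup (ofCoverModel e C μ hC hS hl hp2 hpl hζ hη ι hι hinj Φ hΦ hΦK hZ hN T).Corhat,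
      Cu.IsCuspidalInertia Q' I ↔ I ≤ Q' ∧ ∃ I₀,
        Cu.IsCuspidalInertia (ofCoverModel e C μ hC hS hl hp2 hpl hζ hη ι hι hinj Φ hΦ hΦK hZ hN T).piPM I₀ ∧ I = I₀ ⊓ Q')
    (hpm : ∀ I₀ : Subgroup (ofCoverModel e C μ hC hS hl hp2 hpl hζ hη ι hι hinj Φ hΦ hΦK hZ hN T).Corhat,
      Cu.IsCuspidalInertia (ofCoverModel e C μ hC hS hl hp2 hpl hζ hη ι hι hinj Φ hΦ hΦK hZ hN T).piPM I₀ →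
        ∃ i : {x : M.Pt // M.IsCusp x} × M.GtpC,
          ∃ t ∈ (ofCoverModel e C μ hC hS hl hp2 hpl hζ hη ι hι hinj Φ hΦ hΦK hZ hN T).piPM,
            I₀ = (MulAut.conj t •
              (((MulAut.conj i.2 • (M.toTemperedCurve.inertia i.1.1).map M.inclX) ⊓ (M.GtpXu l).map M.inclX).map
                ι.toMonoidHom :
                Subgroup (ofCoverModel e C μ hC hS hl hp2 hpl hζ hη ι hι hinj Φ hΦ hΦK hZ hN T).Corhat)))
    (habs : M.toTemperedCurve.IsoPreservesCuspidalDecomp M.toTemperedCurve)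
    (hcomm : M.toTemperedCurve.DecompEqCommensuratorOfOpenInertia)
    (hR2 : Thm16Sub.GtpYNFromCusp M.toThetaSetting 2) (H : Subgroup P) :
    ∀ I : Subgroup (ofCoverModel e C μ hC hS hl hp2 hpl hζ hη ι hι hinj Φ hΦ hΦK hZ hN T).Corhat,
      Cu.IsCuspidalInertia (ofCoverModel e C μ hC hS hl hp2 hpl hζ hη ι hι hinj Φ hΦ hΦK hZ hN T).piV I →
        I ≤ (ofCoverModel e C μ hC hS hl hp2 hpl hζ hη ι hι hinj Φ hΦ hΦK hZ hN T).deltaBox H →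
          (ofCoverModel e C μ hC hS hl hp2 hpl hζ hη ι hι hinj Φ hΦ hΦK hZ hN T).cuspDecomp I 1 ≤
            (T.YddL).map ((ofCoverModel e C μ hC hS hl hp2 hpl hζ hη ι hι hinj Φ hΦ hΦK hZ hN T).emb.comp T.incl) :=
  cuspDecomp_one_le_map_YddL_ofCoverModel_of_inter_of_gtpYNFromCusp_two e C μ hC hS hl hp2 hpl hζ hη ι hι hinj Φ hΦ hΦK hZ hN T Cu
    (hint_of_levels_of_members e C μ hC hS hl hp2 hpl hζ hη ι hι hinj Φ hΦ hΦK hZ hN T Cu hlev hpm) habs hcomm hR2 H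

/-- **IUTchII:Cor2.4(ii)(iii)′ at `ofCoverModel` (hence at `ofPiCHat`) for a LEVELS-keyed datum (shape of p433029)**, modulo ⟨node Cor. 2.4 (i)
at the same datum (`h24i`); (S) `hsurj`; (E) `hcap`; `hpm`; F-1704; F-1708; R2 at `N = 2`⟩.  PROVED.
[claim: Mochizuki2012, status: disputed] (IUTchII §2 Cor 2.4 (ii) p.70) -/
theorem cor24_ii_iii'_ofCoverModel_of_levels_of_members
    (Cu : CuspidalInertiaData (ofCoverModel e C μ hC hS hl hp2 hpl hζ hη ι hι hinj Φ hΦ hΦK hZ hN T))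
    (hlev : ∀ Q' I : Subgroup (ofCoverModel e C μ hC hS hl hp2 hpl hζ hη ι hι hinj Φ hΦ hΦK hZ hN T).Corhat,
      Cu.IsCuspidalInertia Q' I ↔ I ≤ Q' ∧ ∃ I₀,
        Cu.IsCuspidalInertia (ofCoverModel e C μ hC hS hl hp2 hpl hζ hη ι hι hinj Φ hΦ hΦK hZ hN T).piPM I₀ ∧ I = I₀ ⊓ Q')
    (hpm : ∀ I₀ : Subgroup (ofCoverModel e C μ hC hS hl hp2 hpl hζ hη ι hι hinj Φ hΦ hΦK hZ hN T).Corhat,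
      Cu.IsCuspidalInertia (ofCoverModel e C μ hC hS hl hp2 hpl hζ hη ι hι hinj Φ hΦ hΦK hZ hN T).piPM I₀ →
        ∃ i : {x : M.Pt // M.IsCusp x} × M.GtpC,
          ∃ t ∈ (ofCoverModel e C μ hC hS hl hp2 hpl hζ hη ι hι hinj Φ hΦ hΦK hZ hN T).piPM,
            I₀ = (MulAut.conj t •
              (((MulAut.conj i.2 • (M.toTemperedCurve.inertia i.1.1).map M.inclX) ⊓ (M.GtpXu l).map M.inclX).map
                ι.toMonoidHom :
                Subgroup (ofCoverModel e C μ hC hS hl hp2 hpl hζ hη ι hι hinj Φ hΦ hΦK hZ hN T).Corhat)))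
    (H : Subgroup P)
    (h24i : ∀ I : Subgroup (ofCoverModel e C μ hC hS hl hp2 hpl hζ hη ι hι hinj Φ hΦ hΦK hZ hN T).Corhat,
      Cu.IsCuspidalInertia (ofCoverModel e C μ hC hS hl hp2 hpl hζ hη ι hι hinj Φ hΦ hΦK hZ hN T).piV I →
        I ≤ (ofCoverModel e C μ hC hS hl hp2 hpl hζ hη ι hι hinj Φ hΦ hΦK hZ hN T).deltaBox H →
          Literature.IUT.HodgeArakelov.Cor24_i (ofCoverModel e C μ hC hS hl hp2 hpl hζ hη ι hι hinj Φ hΦ hΦK hZ hN T) Cu H I)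
    (hsurj : ∀ n : (ofCoverModel e C μ hC hS hl hp2 hpl hζ hη ι hι hinj Φ hΦ hΦK hZ hN T).Corhat,
      n ∈ (ofCoverModel e C μ hC hS hl hp2 hpl hζ hη ι hι hinj Φ hΦ hΦK hZ hN T).piV →
        ∃ m : (ofCoverModel e C μ hC hS hl hp2 hpl hζ hη ι hι hinj Φ hΦ hΦK hZ hN T).Corhat,
          m ∈ (ofCoverModel e C μ hC hS hl hp2 hpl hζ hη ι hι hinj Φ hΦ hΦK hZ hN T).pmBox H ∧
            m⁻¹ * n ∈ (ofCoverModel e C μ hC hS hl hp2 hpl hζ hη ι hι hinj Φ hΦ hΦK hZ hN T).aug.ker)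
    (hcap : (ofCoverModel e C μ hC hS hl hp2 hpl hζ hη ι hι hinj Φ hΦ hΦK hZ hN T).pmBox H ⊓
        (ofCoverModel e C μ hC hS hl hp2 hpl hζ hη ι hι hinj Φ hΦ hΦK hZ hN T).piV ≤
      (ofCoverModel e C μ hC hS hl hp2 hpl hζ hη ι hι hinj Φ hΦ hΦK hZ hN T).box H)
    (habs : M.toTemperedCurve.IsoPreservesCuspidalDecomp M.toTemperedCurve)
    (hcomm : M.toTemperedCurve.DecompEqCommensuratorOfOpenInertia)
    (hR2 : Thm16Sub.GtpYNFromCusp M.toThetaSetting 2) :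
    Literature.IUT.HodgeArakelov.Cor24_ii_iii' (ofCoverModel e C μ hC hS hl hp2 hpl hζ hη ι hι hinj Φ hΦ hΦK hZ hN T) Cu H :=
  cor24_ii_iii'_ofCoverModel_of_inter_of_gtpYNFromCusp_two e C μ hC hS hl hp2 hpl hζ hη ι hι hinj Φ hΦ hΦK hZ hN T Cu
    (hint_of_levels_of_members e C μ hC hS hl hp2 hpl hζ hη ι hι hinj Φ hΦ hΦK hZ hN T Cu hlev hpm) H h24i hsurj hcap habs hcomm hR2

/-- **Non-vacuity for LEVELS-keyed data**: if some member of the tempered cusp family is `Cu`-cuspidal in `Π^±_v`, then its trace on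
`Π_v` is `Cu`-cuspidal in `Π_v` — the `Π_v`-family is inhabited (contrast p442973 for containment-keyed data).  PROVED.
[claim: Mochizuki2012, status: disputed] (IUTchII §2 Def 2.3 (ii), kurims p.68) -/
theorem isCuspidalInertia_piV_inf_of_levels
    (Cu : CuspidalInertiaData (ofCoverModel e C μ hC hS hl hp2 hpl hζ hη ι hι hinj Φ hΦ hΦK hZ hN T))
    (hlev : ∀ Q' I : Subgroup (ofCoverModel e C μ hC hS hl hp2 hpl hζ hη ι hι hinj Φ hΦ hΦK hZ hN T).Corhat,
      Cu.IsCuspidalInertia Q' I ↔ I ≤ Q' ∧ ∃ I₀,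
        Cu.IsCuspidalInertia (ofCoverModel e C μ hC hS hl hp2 hpl hζ hη ι hι hinj Φ hΦ hΦK hZ hN T).piPM I₀ ∧ I = I₀ ⊓ Q')
    {I₀ : Subgroup (ofCoverModel e C μ hC hS hl hp2 hpl hζ hη ι hι hinj Φ hΦ hΦK hZ hN T).Corhat}
    (hI₀ : Cu.IsCuspidalInertia (ofCoverModel e C μ hC hS hl hp2 hpl hζ hη ι hι hinj Φ hΦ hΦK hZ hN T).piPM I₀) :
    Cu.IsCuspidalInertia (ofCoverModel e C μ hC hS hl hp2 hpl hζ hη ι hι hinj Φ hΦ hΦK hZ hN T).piV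
      (I₀ ⊓ (ofCoverModel e C μ hC hS hl hp2 hpl hζ hη ι hι hinj Φ hΦ hΦK hZ hN T).piV) :=
  (hlev _ _).mpr ⟨inf_le_right, I₀, hI₀, rfl⟩

end PlusMinusTower

end Literature.IUT.HodgeArakelov

end
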